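import Mathlib
import Literature.MathematicalPhysics.StatisticalMechanics.BarlowStacking
import Summits.AtomisticToContinuum.Crystallization.Theorems.BraggSlacknessRigidityHcpDiffractionRigidityPlainConfinementTranscAux

/-!
# Plain confinement, transcendental case (stub `stub_plainConfinementTransc` of crux
# `HcpDiffractionRigidity`, item `stmt-AtomisticToContinuum-13166`)

Let `t = h²/a²` be transcendental and let `Λ ∋ 0` be a subset of `ℝ³` all of whose pair
distances are hcp template distances.  Then `Λ` lies in a full-rank discrete lattice `N` whose
Gram matrix lies in `(a² ℤ + h² ℤ)/D`.

* `exists_rat_coord` — for a real basis `B ⊆ S` of a set `S` with `K ⟪x, y⟫ ∈ a² (ℤ + t ℤ)`,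
  every `x ∈ S` is a rational combination of `B`: the family `(B, x)` is `ℝ`-dependent, hence
  `ℚ`-dependent by the Gram pencil lemma (`HcpRigidityPencil.linearIndependent_of_rat`, Aux file);
* `exists_lattice_transc` — abstract plain confinement: the rational coordinates have bounded
  denominators (pair `x` with the `B_j`, compare `(1, t)`-coefficients, and apply a rational left
  inverse of the injective map `c ↦ (c P, c Q)`), so `S` lies in the `ℤ`-span of `B / D₁`;
* `hcp_dist_sq`, `hcp_inner_transc` — template distances are `a² (I² + IJ + J²)/9 + h² m²`, so
  `18 ⟪p, q⟫ ∈ a² (ℤ + t ℤ)` on `Λ` by polarisation;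
* `stub_plainConfinementTransc` — enlarge `Λ` by `a` times an orthonormal basis of `(span Λ)ᗮ`
  and apply `exists_lattice_transc`.

All `[folklore]`.
-/

noncomputable section

namespace Summit.AtomisticToContinuum.Crystallization.Theorems

namespace HcpRigidityPencil

open Module Submodule
open scoped BigOperators RealInnerProductSpace Matrix

/-! ## Plain confinement, abstract form -/

section Core

variable {E : Type*} [NormedAddCommGroup E] [InnerProductSpace ℝ E] [FiniteDimensional ℝ E]

/-- **Rational coordinates.** Let `B` be a real basis with `⟪x, y⟫ ∈ (a²/K)(ℤ + t ℤ)` on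
`S ⊇ range B` (`t` transcendental). Then every `x ∈ S` is a rational combination of `B`
(pencil lemma applied to the `ℝ`-dependent family `(B, x)`). [folklore] -/
theorem exists_rat_coord {ι : Type*} [Fintype ι] {a t : ℝ} (ha : a ≠ 0)
    (ht : Transcendental ℚ t) {K : ℕ} (hK : 0 < K) {S : Set E}
    (hS : ∀ x ∈ S, ∀ y ∈ S, ∃ m n : ℤ, (K : ℝ) * ⟪x, y⟫ = a ^ 2 * (m + t * n))
    (B : Basis ι ℝ E) (hBS : ∀ i, B i ∈ S) {x : E} (hx : x ∈ S) :
    ∃ c : ι → ℚ, x = ∑ i, ((c i : ℚ) : ℝ) • B i := by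
  classical
  have hBQ : ∀ c : ι → ℚ, ∑ i, ((c i : ℚ) : ℝ) • B i = 0 → c = 0 := fun c hc => by
    have h1 := Fintype.linearIndependent_iff.1 B.linearIndependent (fun i => (c i : ℝ)) hc
    funext i
    exact_mod_cast h1 i
  set u : Option ι → E := fun o => o.elim x (fun i => B i) with hu_def
  have huS : ∀ o, u o ∈ S := by
    rintro (_ | i)
    exacts [hx, hBS i]
  obtain ⟨P, Q, -, -, hG⟩ := exists_rat_gram hK u fun k l => hS _ (huS k) _ (huS l)
  obtain ⟨hPs, hQs⟩ := isSymm_of_gram ha (irrational_of_transcendental ht) hG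
  have hdep : ¬ LinearIndependent ℝ u := fun hli => by
    have h1 := hli.fintype_card_le_finrank
    rw [Fintype.card_option, Module.finrank_eq_card_basis B] at h1
    omega
  have h2 : ¬ ∀ c : Option ι → ℚ, ∑ o, ((c o : ℚ) : ℝ) • u o = 0 → c = 0 :=
    fun h => hdep (linearIndependent_of_rat ha ht hPs hQs hG h)
  push Not at h2
  obtain ⟨c, hc, hc0⟩ := h2
  rw [Fintype.sum_option] at hc
  have hcn : c none ≠ 0 := fun h0 => by
    rw [h0, Rat.cast_zero, zero_smul, zero_add] at hc
    apply hc0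
    funext o
    cases o with
    | none => exact h0
    | some i => exact congr_fun (hBQ (fun i => c (some i)) hc) i
  have hcnR : ((c none : ℚ) : ℝ) ≠ 0 := by exact_mod_cast hcn
  refine ⟨fun i => -(c (some i) / c none), ?_⟩
  have hx' : ((c none : ℚ) : ℝ) • x = -∑ i, ((c (some i) : ℚ) : ℝ) • B i :=
    eq_neg_of_add_eq_zero_left hc
  calc x = ((c none : ℚ) : ℝ)⁻¹ • (((c none : ℚ) : ℝ) • x) := by
        rw [smul_smul, inv_mul_cancel₀ hcnR, one_smul]
    _ = ∑ i, ((-(c (some i) / c none) : ℚ) : ℝ) • B i := by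
        rw [hx', smul_neg, Finset.smul_sum, ← Finset.sum_neg_distrib]
        refine Finset.sum_congr rfl fun i _ => ?_
        rw [smul_smul, ← neg_smul]
        push_cast
        rw [div_eq_inv_mul]

/-- **Plain confinement, abstract form.** Let `S` span the finite-dimensional real inner
product space `E`, with `K ⟪x, y⟫ ∈ a² (ℤ + t ℤ)` for `x, y ∈ S` (`a ≠ 0`, `t` transcendental).
Then `S` lies in a full-rank discrete lattice `N` with `D ⟪u, v⟫ ∈ a² (ℤ + t ℤ)` on `N` for one
`D > 0`: the `ℤ`-span of `B / D₁` for a basis `B ⊆ S` (rational coordinates by the pencil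
lemma, bounded denominators by a rational left inverse of `c ↦ (c P, c Q)`). [folklore] -/
theorem exists_lattice_transc {a t : ℝ} (ha : a ≠ 0) (ht : Transcendental ℚ t) {K : ℕ}
    (hK : 0 < K) {S : Set E} (hsp : span ℝ S = ⊤)
    (hS : ∀ x ∈ S, ∀ y ∈ S, ∃ m n : ℤ, (K : ℝ) * ⟪x, y⟫ = a ^ 2 * (m + t * n)) :
    ∃ N : Submodule ℤ E, DiscreteTopology N ∧ span ℝ (N : Set E) = ⊤ ∧
      ∃ D : ℕ, 0 < D ∧ (∀ u ∈ N, ∀ v ∈ N, ∃ m n : ℤ, (D : ℝ) * ⟪u, v⟫ = a ^ 2 * (m + t * n)) ∧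
        S ⊆ N := by
  classical
  -- a real basis inside `S`
  obtain ⟨b, hbS, hbsp, hbli⟩ := exists_linearIndependent ℝ S
  have hbtop : ⊤ ≤ span ℝ (Set.range ((↑) : b → E)) := by
    rw [Subtype.range_coe, hbsp, hsp]
  set B : Basis b ℝ E := Basis.mk hbli hbtop with hB_def
  have hB : ∀ i, B i = (i : E) := fun i => by rw [hB_def, Basis.mk_apply]
  haveI : Finite b := Module.Finite.finite_basis B
  letI : Fintype b := Fintype.ofFinite b
  have hBS : ∀ i, B i ∈ S := fun i => hB i ▸ hbS i.2
  have hBQ : ∀ c : b → ℚ, ∑ i, ((c i : ℚ) : ℝ) • B i = 0 → c = 0 := fun c hc => by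
    have h1 := Fintype.linearIndependent_iff.1 B.linearIndependent (fun i => (c i : ℝ)) hc
    funext i
    exact_mod_cast h1 i
  have hirr := irrational_of_transcendental ht
  obtain ⟨P, Q, hPK, hQK, hG⟩ := exists_rat_gram hK (fun i => B i) fun k l =>
    hS _ (hBS k) _ (hBS l)
  -- rational coordinates of the points of `S`
  have hrat : ∀ x ∈ S, ∃ c : b → ℚ, x = ∑ i, ((c i : ℚ) : ℝ) • B i := fun x hx =>
    exists_rat_coord ha ht hK hS B hBS hx
  choose cf hcf using hrat
  have hpair : ∀ x (hx : x ∈ S) j, (∃ m : ℤ, (K : ℚ) * (cf x hx ᵥ* P) j = m) ∧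
      ∃ n : ℤ, (K : ℚ) * (cf x hx ᵥ* Q) j = n := by
    intro x hx j
    obtain ⟨m, n, hmn⟩ := hS x hx (B j) (hBS j)
    have h1 := inner_sum_smul_left hG (cf x hx) j
    rw [← hcf x hx] at h1
    have h2 : (((K : ℚ) * (cf x hx ᵥ* P) j : ℚ) : ℝ) + t * (((K : ℚ) * (cf x hx ᵥ* Q) j : ℚ) : ℝ)
        = ((m : ℚ) : ℝ) + t * ((n : ℚ) : ℝ) := by
      apply mul_left_cancel₀ (pow_ne_zero 2 ha)
      push_cast
      linear_combination (K : ℝ) * h1.symm + hmn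
    obtain ⟨h3, h4⟩ := coeff_unique hirr h2
    exact ⟨⟨m, h3⟩, ⟨n, h4⟩⟩
  -- the map `c ↦ (c P, c Q)` is injective, hence has a rational left inverse
  set Φ : (b → ℚ) →ₗ[ℚ] (b ⊕ b → ℚ) := Matrix.vecMulLinear (Matrix.fromCols P Q) with hΦ_def
  have hΦ : ∀ c, Φ c = Sum.elim (c ᵥ* P) (c ᵥ* Q) := fun c => by
    rw [hΦ_def]
    exact Matrix.vecMul_fromCols P Q c
  have hker : LinearMap.ker Φ = ⊥ := by
    refine LinearMap.ker_eq_bot'.2 fun c hc => hBQ c ?_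
    rw [hΦ] at hc
    have hP0 : ∀ j, (c ᵥ* P) j = 0 := fun j => by simpa using congr_fun hc (Sum.inl j)
    have hQ0 : ∀ j, (c ᵥ* Q) j = 0 := fun j => by simpa using congr_fun hc (Sum.inr j)
    refine InnerProductSpace.ext_inner_right_basis B fun j => ?_
    rw [inner_zero_left, inner_sum_smul_left hG, hP0, hQ0]
    simp
  obtain ⟨Ψ, hΨ⟩ := Φ.exists_leftInverse_of_injective hker
  -- bounded denominators of the rational coordinates
  have hden : ∀ i, ∃ D : ℕ, 0 < D ∧ ∀ x (hx : x ∈ S), ∃ z : ℤ, (D : ℚ) * cf x hx i = z := by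
    intro i
    obtain ⟨D, hD, hDi⟩ := exists_denom Ψ i
    refine ⟨D * K, Nat.mul_pos hD hK, fun x hx => ?_⟩
    have h1 : Ψ (Φ ((K : ℚ) • cf x hx)) = (K : ℚ) • cf x hx := by
      rw [← LinearMap.comp_apply, hΨ, LinearMap.id_apply]
    have h2 : ∀ s, ∃ z : ℤ, Φ ((K : ℚ) • cf x hx) s = z := by
      intro s
      rw [map_smul, hΦ, Pi.smul_apply, smul_eq_mul]
      rcases s with j | j
      · rw [Sum.elim_inl]
        exact (hpair x hx j).1
      · rw [Sum.elim_inr]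
        exact (hpair x hx j).2
    obtain ⟨z, hz⟩ := hDi _ h2
    rw [h1, Pi.smul_apply, smul_eq_mul] at hz
    exact ⟨z, by rw [← hz]; push_cast; ring⟩
  choose Dv hDv hDvi using hden
  set D₁ : ℕ := ∏ i, Dv i with hD₁_def
  have hD₁ : 0 < D₁ := Finset.prod_pos fun i _ => hDv i
  have hint : ∀ x (hx : x ∈ S) i, ∃ z : ℤ, (D₁ : ℚ) * cf x hx i = z := by
    intro x hx i
    obtain ⟨k, hk⟩ : Dv i ∣ D₁ := Finset.dvd_prod_of_mem _ (Finset.mem_univ i)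
    obtain ⟨z, hz⟩ := hDvi i x hx
    refine ⟨k * z, ?_⟩
    rw [hk]
    push_cast
    rw [← hz]
    ring
  -- the lattice: `ℤ`-span of `B / D₁`
  have hD₁R : (D₁ : ℝ) ≠ 0 := by exact_mod_cast hD₁.ne'
  set B' : Basis b ℝ E := B.unitsSMul fun _ => Units.mk0 (D₁ : ℝ)⁻¹ (inv_ne_zero hD₁R)
    with hB'_def
  have hB' : ∀ i, B' i = (D₁ : ℝ)⁻¹ • B i := fun i => by
    rw [hB'_def, Basis.unitsSMul_apply]
    rfl
  refine ⟨span ℤ (Set.range ⇑B'), inferInstance, ZSpan.span_top B', K * D₁ ^ 2, by positivity,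
    ?_, ?_⟩
  · -- Gram integrality on the lattice
    apply gram_span
    rintro _ ⟨i, rfl⟩ _ ⟨j, rfl⟩
    obtain ⟨m, hm⟩ := hPK i j
    obtain ⟨n, hn⟩ := hQK i j
    have hm' : (K : ℝ) * (P i j : ℝ) = m := by exact_mod_cast hm
    have hn' : (K : ℝ) * (Q i j : ℝ) = n := by exact_mod_cast hn
    refine ⟨m, n, ?_⟩
    rw [hB', hB', real_inner_smul_left, real_inner_smul_right, hG, ← hm', ← hn']
    push_cast
    field_simp
  · -- `S` lies in the lattice
    intro x hx
    choose z hz using hint x hx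
    have hxe : x = ∑ i, (z i : ℝ) • B' i := by
      conv_lhs => rw [hcf x hx]
      refine Finset.sum_congr rfl fun i _ => ?_
      have hz' : (z i : ℝ) = (D₁ : ℝ) * (cf x hx i : ℝ) := by exact_mod_cast (hz i).symm
      rw [hB', smul_smul, hz', mul_right_comm, mul_inv_cancel₀ hD₁R, one_mul]
    rw [hxe]
    refine Submodule.sum_mem _ fun i _ => ?_
    rw [Int.cast_smul_eq_zsmul ℝ (z i)]
    exact Submodule.smul_mem _ _ (Submodule.subset_span (Set.mem_range_self i))

end Core

/-! ## The hcp template -/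

open Literature.MathematicalPhysics.StatisticalMechanics

/-- **Template distances.** Every squared distance of the hcp template is
`a² (I² + IJ + J²) / 9 + h² m²` with integers `I, J, m`. [folklore] -/
theorem hcp_dist_sq {a h : ℝ} (ha : a ≠ 0) (hh : h ≠ 0) {x y : EuclideanSpace ℝ (Fin 3)}
    (hx : x ∈ (hcpPeriodicConfiguration ha hh).points)
    (hy : y ∈ (hcpPeriodicConfiguration ha hh).points) :
    ∃ I J m : ℤ, dist x y ^ 2 = a ^ 2 * (((I : ℝ) ^ 2 + I * J + J ^ 2) / 9) + h ^ 2 * (m : ℝ) ^ 2 := by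
  rw [hcpPeriodicConfiguration_points] at hx hy
  obtain ⟨k, i, j, rfl⟩ := mem_barlowStacking_iff.1 hx
  obtain ⟨k', i', j', rfl⟩ := mem_barlowStacking_iff.1 hy
  refine ⟨3 * (i - i') + (haggLabel alternatingHagg k - haggLabel alternatingHagg k'),
    3 * (j - j') + (haggLabel alternatingHagg k - haggLabel alternatingHagg k'), k - k', ?_⟩
  rw [dist_barlowPos_sq]
  have h3 : (√3 : ℝ) ^ 2 = 3 := Real.sq_sqrt (by norm_num)
  push_cast
  linear_combination (a ^ 2 * (((j : ℝ) - j') +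
    ((haggLabel alternatingHagg k : ℝ) - haggLabel alternatingHagg k') / 3) ^ 2 / 4) * h3

/-- **Inner products of a template-exact set.** If `0 ∈ Λ` and all pair distances of `Λ` are hcp
template distances, then `18 ⟪p, q⟫ = a² (u + (h²/a²) v)` with integers `u, v`, for `p, q ∈ Λ`
(polarisation of `hcp_dist_sq`). [folklore] -/
theorem hcp_inner_transc {a h : ℝ} (ha : a ≠ 0) (hh : h ≠ 0)
    {Λ : Set (EuclideanSpace ℝ (Fin 3))} (h0 : (0 : EuclideanSpace ℝ (Fin 3)) ∈ Λ)
    (hΛ : ∀ p ∈ Λ, ∀ q ∈ Λ, ∃ a' ∈ (hcpPeriodicConfiguration ha hh).points,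
      ∃ b' ∈ (hcpPeriodicConfiguration ha hh).points, dist p q = dist a' b')
    {p q : EuclideanSpace ℝ (Fin 3)} (hp : p ∈ Λ) (hq : q ∈ Λ) :
    ∃ u v : ℤ, ((18 : ℕ) : ℝ) * ⟪p, q⟫ = a ^ 2 * (u + h ^ 2 / a ^ 2 * v) := by
  have hD : ∀ p ∈ Λ, ∀ q ∈ Λ, ∃ I J m : ℤ,
      dist p q ^ 2 = a ^ 2 * (((I : ℝ) ^ 2 + I * J + J ^ 2) / 9) + h ^ 2 * (m : ℝ) ^ 2 := by
    intro p hp q hq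
    obtain ⟨a', ha', b', hb', hpq⟩ := hΛ p hp q hq
    obtain ⟨I, J, m, hd⟩ := hcp_dist_sq ha hh ha' hb'
    exact ⟨I, J, m, by rw [hpq, hd]⟩
  obtain ⟨I₁, J₁, m₁, h₁⟩ := hD p hp 0 h0
  obtain ⟨I₂, J₂, m₂, h₂⟩ := hD q hq 0 h0
  obtain ⟨I₃, J₃, m₃, h₃⟩ := hD p hp q hq
  rw [dist_zero_right] at h₁ h₂
  rw [dist_eq_norm] at h₃
  have ha2 : a ^ 2 ≠ 0 := pow_ne_zero 2 ha
  refine ⟨(I₁ ^ 2 + I₁ * J₁ + J₁ ^ 2) + (I₂ ^ 2 + I₂ * J₂ + J₂ ^ 2) - (I₃ ^ 2 + I₃ * J₃ + J₃ ^ 2),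
    9 * (m₁ ^ 2 + m₂ ^ 2 - m₃ ^ 2), ?_⟩
  rw [real_inner_eq_norm_mul_self_add_norm_mul_self_sub_norm_sub_mul_self_div_two]
  push_cast
  field_simp
  linear_combination 18 * h₁ + 18 * h₂ - 18 * h₃

end HcpRigidityPencil

open Literature.MathematicalPhysics.StatisticalMechanics Module Submodule
open scoped RealInnerProductSpace

/-- **STUB — plain confinement, transcendental case.** Let `t = h²/a²` be transcendental and let
`Λ ∋ 0` have all pair distances among the hcp template distances, so that
`18 ⟪p, q⟫ ∈ a² (ℤ + t ℤ)` on `Λ` (polarisation). Enlarge `Λ` by `a` times an orthonormal basis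
of `(span Λ)ᗮ` to a spanning set `S` with the same property. By the Gram pencil lemma every
`x ∈ S` is a rational combination of a basis `B ⊆ S`, with denominators bounded through a
rational left inverse of `c ↦ (c P, c Q)`; hence `Λ ⊆ S` lies in the `ℤ`-span `N` of `B / D₁`, a
full-rank discrete lattice whose Gram matrix lies in `(a² ℤ + h² ℤ) / D`. [folklore] -/
theorem stub_plainConfinementTransc : ∀ (a h : ℝ) (ha : a ≠ 0) (hh : h ≠ 0), Transcendental ℚ (h ^ 2 / a ^ 2) → ∀ Λ : Set (EuclideanSpace ℝ (Fin 3)), (0 : EuclideanSpace ℝ (Fin 3)) ∈ Λ → (∀ p ∈ Λ, ∀ q ∈ Λ, ∃ a' ∈ (Literature.MathematicalPhysics.StatisticalMechanics.hcpPeriodicConfiguration ha hh).points, ∃ b' ∈ (Literature.MathematicalPhysics.StatisticalMechanics.hcpPeriodicConfiguration ha hh).points, dist p q = dist a' b') → ∃ (N : Submodule ℤ (EuclideanSpace ℝ (Fin 3))) (D : ℕ), DiscreteTopology N ∧ Submodule.span ℝ (N : Set (EuclideanSpace ℝ (Fin 3))) = ⊤ ∧ 0 < D ∧ (∀ u ∈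 N, ∀ v ∈ N, ∃ n₁ n₂ : ℤ, (D : ℝ) * inner ℝ u v = (n₁ : ℝ) * a ^ 2 + (n₂ : ℝ) * h ^ 2) ∧ Λ ⊆ N := by
  intro a h ha hh htr Λ h0 hΛ
  classical
  have ha2 : a ^ 2 ≠ 0 := pow_ne_zero 2 ha
  have hth : a ^ 2 * (h ^ 2 / a ^ 2) = h ^ 2 := mul_div_cancel₀ _ ha2
  -- enlarge `Λ` to a spanning set
  set V : Submodule ℝ (EuclideanSpace ℝ (Fin 3)) := span ℝ Λ with hV
  set ob := stdOrthonormalBasis ℝ Vᗮ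
  obtain ⟨e, he⟩ : ∃ e : Fin (finrank ℝ Vᗮ) → EuclideanSpace ℝ (Fin 3),
    e = fun i => a • (ob i : EuclideanSpace ℝ (Fin 3)) := ⟨_, rfl⟩
  have h1 : ∀ p ∈ Λ, ∀ i, ⟪p, e i⟫ = 0 := by
    intro p hp i
    rw [he, real_inner_smul_right,
      Submodule.inner_right_of_mem_orthogonal (Submodule.subset_span hp) (ob i).2, mul_zero]
  have h2 : ∀ i j, ⟪e i, e j⟫ = if i = j then a ^ 2 else 0 := by
    intro i j
    rw [he]
    simp only [real_inner_smul_left, real_inner_smul_right, ← Submodule.coe_inner]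
    rw [orthonormal_iff_ite.1 ob.orthonormal i j]
    split_ifs
    · ring
    · rw [mul_zero, mul_zero]
  have hS : ∀ x ∈ Λ ∪ Set.range e, ∀ y ∈ Λ ∪ Set.range e, ∃ m n : ℤ,
      ((18 : ℕ) : ℝ) * ⟪x, y⟫ = a ^ 2 * (m + h ^ 2 / a ^ 2 * n) := by
    rintro x (hx | ⟨i, rfl⟩) y (hy | ⟨j, rfl⟩)
    · exact HcpRigidityPencil.hcp_inner_transc ha hh h0 hΛ hx hy
    · exact ⟨0, 0, by rw [h1 x hx j]; simp⟩
    · exact ⟨0, 0, by rw [real_inner_comm, h1 y hy i]; simp⟩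
    · by_cases hij : i = j
      · exact ⟨18, 0, by rw [h2, if_pos hij]; push_cast; ring⟩
      · exact ⟨0, 0, by rw [h2, if_neg hij]; simp⟩
  have hVo : Vᗮ ≤ span ℝ (Set.range e) := by
    intro y hy
    have h3 : ∑ i, (ob.repr ⟨y, hy⟩ i * a⁻¹) • e i = y := by
      have h4 := congrArg (fun z : Vᗮ => (z : EuclideanSpace ℝ (Fin 3))) (ob.sum_repr ⟨y, hy⟩)
      simp only [Submodule.coe_sum, Submodule.coe_smul] at h4
      refine Eq.trans (Finset.sum_congr rfl fun i _ => ?_) h4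
      rw [he, smul_smul, mul_assoc, inv_mul_cancel₀ ha, mul_one]
    rw [← h3]
    exact Submodule.sum_mem _ fun i _ =>
      Submodule.smul_mem _ _ (Submodule.subset_span (Set.mem_range_self i))
  have hsp : span ℝ (Λ ∪ Set.range e) = ⊤ := by
    rw [Submodule.span_union, eq_top_iff, ← Submodule.sup_orthogonal_of_hasOrthogonalProjection
      (K := V)]
    exact sup_le_sup_left hVo V
  obtain ⟨N, hNd, hNsp, D, hD, hND, hsub⟩ :=
    HcpRigidityPencil.exists_lattice_transc ha htr (by norm_num : 0 < 18) hsp hS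
  refine ⟨N, D, hNd, hNsp, hD, fun u hu v hv => ?_, fun x hx => hsub (Set.mem_union_left _ hx)⟩
  obtain ⟨m, n, hmn⟩ := hND u hu v hv
  exact ⟨m, n, by rw [hmn]; linear_combination (n : ℝ) * hth⟩


end Summit.AtomisticToContinuum.Crystallization.Theorems

end
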